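import Literature.NumberTheory.EllipticCurves.KuriharaNumber
import HarnessLib

/-!
# Tame depth, I: the projection (norm) formula; the twisted depth polynomial (definitions)

Summit `BirchSwinnertonDyer`, solo-informed study, kernel file no. 18a (attempt A74, claim C62):
the form-free engine and the definitions for `SoloInformedTameDepth` (statement, meaning, proof
sketch and sources there). All proved. ENGINE (elementary algebra over a commutative ring `R`): for
`φ : ℚ → R` with `φ(x + 1) = φ(x)`, primes `ℓ ≠ ℓ'`, `n = ℓ ℓ'`, `u = ℓ' mod ℓ`, and the Hecke
relation `a' φ(x) = ∑_{j mod ℓ'} φ((x + j)/ℓ') + φ(ℓ' x)` as a HYPOTHESIS at the points `x = b/ℓ`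
(for `x ↦ [x]⁺_f` this is the tree's `intCast_mul_ratPlusSymbol`): `solo_sum_fiber` (the fibre
of `(ℤ/n)ˣ → (ℤ/ℓ)ˣ` over `b` sums to `a' φ(b/ℓ) - φ(bu/ℓ) - φ(bu⁻¹/ℓ)`),
`solo_sum_units_mul_apply` (**projection formula**
`∑_{a ∈ (ℤ/n)ˣ} φ(a/n) c(a mod ℓ) = a' ∑_b φ(b/ℓ) c(b) - ∑_b φ(b/ℓ) (c(bu) + c(bu⁻¹))`),
`solo_sum_units_mul_apply_of_shift`, `solo_sum_units_apply_div` (one prime: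
`∑_b φ(b/ℓ) = (a - 2) φ(0)`) — the Hecke/norm relations of Mazur–Tate modular elements
[cite: MazurTate1987, §1]; [cite: Kurihara2014, §1.1 (PDF p. 2)]. DEFINITIONS (for a weight-`2`
cusp form `f` on `Γ₀(N)` and a prime `p`): `soloSymbolModP f p x = \overline{[x]⁺_f} ∈ 𝔽_p`,
`soloCharSum p n ψ a = Ψ(a) = ∑_{ℓ ∣ n} ψ_ℓ(a mod ℓ) ∈ ℤ/p`, and the twisted depth polynomial
`soloTwistedDepthPolynomial f p n ψ = T(X) = ∑_{a ∈ (ℤ/n)ˣ} \overline{[a/n]⁺} (1 + X)^{Ψ(a)}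
∈ 𝔽_p[X]` with its coefficient formula `coeff_k T = ∑_a \overline{[a/n]⁺} C(Ψ(a), k)`.
-/

noncomputable section

open scoped MatrixGroups ModularForm
open CongruenceSubgroup Polynomial
open Literature.NumberTheory.EllipticCurves Literature.NumberTheory.EllipticCurves.ModularForms

namespace Summit.BirchSwinnertonDyer.BirchSwinnertonDyer.Theorems

section Engine

variable {R : Type*}

/-- A sum over the units of a finite field is the sum over all elements minus the term at `0`.
[folklore] -/
theorem solo_sum_units_eq_sub [AddCommGroup R] {K : Type*} [Field K] [Fintype K] [DecidableEq K]
    (H : K → R) :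
    ∑ u : Kˣ, H u = (∑ x : K, H x) - H 0 := by
  rw [← Finset.add_sum_erase Finset.univ H (Finset.mem_univ (0 : K)), add_sub_cancel_left]
  refine Finset.sum_nbij' (fun u => (u : K)) (fun x => if h : x = 0 then 1 else Units.mk0 x h)
    ?_ ?_ ?_ ?_ ?_
  · intro u _; exact Finset.mem_erase.mpr ⟨u.ne_zero, Finset.mem_univ _⟩
  · intro x _; exact Finset.mem_univ _
  · intro u _; simp [u.ne_zero]
  · intro x hx; simp [Finset.ne_of_mem_erase hx]
  · intro u _; rfl

/-- `∑_{x ∈ ℤ/m} H(x.val) = ∑_{j < m} H(j)`. [folklore] -/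
theorem solo_sum_zmod_val {M : Type*} [AddCommMonoid M] (m : ℕ) [NeZero m] (H : ℕ → M) :
    ∑ x : ZMod m, H x.val = ∑ j : Fin m, H j := by
  symm
  refine Fintype.sum_bijective (fun j : Fin m => ((j : ℕ) : ZMod m)) ?_ (fun j => H j)
    (fun x => H x.val) ?_
  · refine (Fintype.bijective_iff_injective_and_card _).mpr ⟨?_, by simp [ZMod.card]⟩
    intro i j h
    have h' := congrArg ZMod.val h
    simp only [ZMod.val_cast_of_lt i.isLt, ZMod.val_cast_of_lt j.isLt] at h'
    exact Fin.ext h'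
  · intro j
    simp only [ZMod.val_cast_of_lt j.isLt]

variable (φ : ℚ → R)

/-- `φ(k/m) = φ(k'/m)` for `k ≡ k' (mod m)` and `φ` `1`-periodic. [folklore] -/
theorem solo_apply_div_eq_of_modEq (hper : ∀ (q : ℚ) (z : ℤ), φ (q + z) = φ q) {m : ℕ}
    (hm : m ≠ 0) {k k' : ℕ} (h : k ≡ k' [MOD m]) :
    φ ((k : ℚ) / m) = φ ((k' : ℚ) / m) := by
  obtain ⟨z, hz⟩ := Nat.modEq_iff_dvd.mp h
  have hm' : (m : ℚ) ≠ 0 := by exact_mod_cast hm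
  have hk' : (k' : ℚ) = k + m * z := by
    have := congrArg (fun t : ℤ => (t : ℚ)) hz
    push_cast at this
    linarith
  have hq : (k' : ℚ) / m = (k : ℚ) / m + (z : ℚ) := by
    rw [hk']; field_simp
  rw [hq, hper]

/-- `φ(\overline{k}.val / m) = φ(k / m)`. [folklore] -/
theorem solo_apply_val_natCast_div (hper : ∀ (q : ℚ) (z : ℤ), φ (q + z) = φ q) {m : ℕ}
    [NeZero m] (k : ℕ) : φ ((((k : ZMod m)).val : ℚ) / m) = φ ((k : ℚ) / m) :=
  solo_apply_div_eq_of_modEq φ hper (NeZero.ne m)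
    (by rw [ZMod.val_natCast]; exact Nat.mod_modEq k m)

/-- **One prime**: `∑_{b ∈ (ℤ/ℓ)ˣ} φ(b/ℓ) = (a - 2) φ(0)` from the Hecke relation at `x = 0`,
`a φ(0) = ∑_{j mod ℓ} φ(j/ℓ) + φ(0)`. [folklore] -/
theorem solo_sum_units_apply_div [CommRing R] (ℓ : ℕ) [Fact ℓ.Prime] (a : R)
    (hH : a * φ 0 = ∑ j : Fin ℓ, φ (((0 : ℚ) + j) / ℓ) + φ (ℓ * 0)) :
    ∑ b : (ZMod ℓ)ˣ, φ (((b : ZMod ℓ).val : ℚ) / ℓ) = (a - 2) * φ 0 := by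
  have h1 : ∑ b : (ZMod ℓ)ˣ, φ (((b : ZMod ℓ).val : ℚ) / ℓ) =
      (∑ x : ZMod ℓ, φ ((x.val : ℚ) / ℓ)) - φ (((0 : ZMod ℓ).val : ℚ) / ℓ) :=
    solo_sum_units_eq_sub (fun x : ZMod ℓ => φ ((x.val : ℚ) / ℓ))
  rw [h1, ZMod.val_zero, Nat.cast_zero, zero_div,
    solo_sum_zmod_val ℓ (fun k => φ ((k : ℚ) / ℓ))]
  simp only [zero_add, mul_zero] at hH
  linear_combination -hH

variable {ℓ ℓ' n : ℕ} [hℓ : Fact ℓ.Prime] [hℓ' : Fact ℓ'.Prime] [NeZero n]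

/-- **The fibre lemma.** For `n = ℓ ℓ'` (distinct primes), `b ∈ (ℤ/ℓ)ˣ` and `u = ℓ' mod ℓ`:
`∑_{a ∈ (ℤ/n)ˣ, a ≡ b (ℓ)} φ(a/n) = a' φ(b/ℓ) - φ(bu/ℓ) - φ(bu⁻¹/ℓ)`, from the Hecke relation
at `ℓ'` applied at `x = b/ℓ` (the `ℓ'` points `(b/ℓ + j)/ℓ'` are the residues `a ≡ b (mod ℓ)`
modulo `n`, exactly one of which, `a = ℓ' c` with `c ≡ ℓ'⁻¹ b`, is not a unit). [folklore] -/
theorem solo_sum_fiber [CommRing R] (hper : ∀ (q : ℚ) (z : ℤ), φ (q + z) = φ q) (hn : n = ℓ * ℓ')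
    (hne : ℓ ≠ ℓ') (hℓn : ℓ ∣ n) (a' : R) (b : (ZMod ℓ)ˣ)
    (hH : a' * φ (((b : ZMod ℓ).val : ℚ) / ℓ) =
      ∑ j : Fin ℓ', φ (((((b : ZMod ℓ).val : ℚ) / ℓ) + j) / ℓ') +
        φ (ℓ' * ((((b : ZMod ℓ).val : ℚ) / ℓ))))
    (u : (ZMod ℓ)ˣ) (hu : (u : ZMod ℓ) = (ℓ' : ZMod ℓ)) :
    ∑ a ∈ (Finset.univ : Finset (ZMod n)ˣ).filter (fun a => ZMod.unitsMap hℓn a = b),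
        φ ((((a : ZMod n)).val : ℚ) / n) =
      a' * φ (((b : ZMod ℓ).val : ℚ) / ℓ) - φ ((((b * u : (ZMod ℓ)ˣ) : ZMod ℓ).val : ℚ) / ℓ)
        - φ ((((b * u⁻¹ : (ZMod ℓ)ˣ) : ZMod ℓ).val : ℚ) / ℓ) := by
  classical
  have hℓp : ℓ.Prime := hℓ.out
  have hℓ'p : ℓ'.Prime := hℓ'.out
  have hℓ0 : ℓ ≠ 0 := hℓp.ne_zero
  have hℓ'0 : ℓ' ≠ 0 := hℓ'p.ne_zero
  have hℓQ : (ℓ : ℚ) ≠ 0 := by exact_mod_cast hℓ0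
  have hℓ'Q : (ℓ' : ℚ) ≠ 0 := by exact_mod_cast hℓ'0
  have hnQ : (n : ℚ) = ℓ * ℓ' := by rw [hn]; push_cast; ring
  set B : ℕ := (b : ZMod ℓ).val with hBdef
  have hBlt : B < ℓ := ZMod.val_lt _
  have hB0 : B ≠ 0 := by
    rw [hBdef, ne_eq, ZMod.val_eq_zero]; exact b.ne_zero
  have hBb : ((B : ℕ) : ZMod ℓ) = (b : ZMod ℓ) := ZMod.natCast_zmod_val _
  -- `ℓ` is a unit mod `ℓ'` and `ℓ'` is a unit mod `ℓ`
  have hcop : Nat.Coprime ℓ ℓ' := (Nat.coprime_primes hℓp hℓ'p).mpr hne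
  have hℓu' : (ℓ : ZMod ℓ') ≠ 0 := by
    rw [ne_eq, ZMod.natCast_eq_zero_iff]
    intro h; exact hne ((Nat.prime_dvd_prime_iff_eq hℓ'p hℓp).mp h).symm
  -- (i) the points of the Hecke relation are `(B + ℓ j)/n`
  have e1 : ∀ j : ℕ, (((B : ℚ) / ℓ) + j) / ℓ' = ((B + ℓ * j : ℕ) : ℚ) / n := by
    intro j; rw [hnQ]; push_cast; field_simp
  -- (ii) `φ(ℓ' B/ℓ) = φ((b u).val/ℓ)`
  have e2 : φ (ℓ' * (((B : ℚ) / ℓ))) = φ ((((b * u : (ZMod ℓ)ˣ) : ZMod ℓ).val : ℚ) / ℓ) := by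
    have hbu : ((b * u : (ZMod ℓ)ˣ) : ZMod ℓ) = ((B * ℓ' : ℕ) : ZMod ℓ) := by
      rw [Units.val_mul, hu, ← hBb]; push_cast; ring
    rw [hbu, solo_apply_val_natCast_div φ hper]
    congr 1; push_cast; field_simp
  -- (iii) the unique non-unit point: `j₀` with `ℓ' ∣ B + ℓ j₀`
  set w : ZMod ℓ' := -((B : ZMod ℓ') * (ℓ : ZMod ℓ')⁻¹) with hwdef
  set j₀ : Fin ℓ' := ⟨w.val, ZMod.val_lt w⟩ with hj₀def
  have hj₀ : ℓ' ∣ B + ℓ * (j₀ : ℕ) := by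
    rw [← ZMod.natCast_eq_zero_iff]
    have : ((j₀ : ℕ) : ZMod ℓ') = w := ZMod.natCast_zmod_val w
    push_cast
    rw [this, hwdef, mul_neg, mul_left_comm, mul_inv_cancel₀ hℓu', mul_one, add_neg_cancel]
  have huniq : ∀ j : Fin ℓ', ℓ' ∣ B + ℓ * (j : ℕ) → j = j₀ := by
    intro j hj
    have h1 : ((B : ZMod ℓ') + ℓ * ((j : ℕ) : ZMod ℓ')) =
        (B : ZMod ℓ') + ℓ * ((j₀ : ℕ) : ZMod ℓ') := by
      have a1 := (ZMod.natCast_eq_zero_iff _ _).mpr hj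
      have a2 := (ZMod.natCast_eq_zero_iff _ _).mpr hj₀
      push_cast at a1 a2
      rw [a1, a2]
    have h2 : ((j : ℕ) : ZMod ℓ') = ((j₀ : ℕ) : ZMod ℓ') :=
      mul_left_cancel₀ hℓu' (add_left_cancel h1)
    have h3 := congrArg ZMod.val h2
    rw [ZMod.val_cast_of_lt j.isLt, ZMod.val_cast_of_lt j₀.isLt] at h3
    exact Fin.ext h3
  -- the value at `j₀`: `B + ℓ j₀ = ℓ' c`, `φ((B + ℓ j₀)/n) = φ(c/ℓ) = φ((b u⁻¹).val/ℓ)`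
  obtain ⟨c, hc⟩ := hj₀
  have e3 : φ (((B + ℓ * (j₀ : ℕ) : ℕ) : ℚ) / n) =
      φ ((((b * u⁻¹ : (ZMod ℓ)ˣ) : ZMod ℓ).val : ℚ) / ℓ) := by
    have hcZ : ((c : ℕ) : ZMod ℓ) = ((b * u⁻¹ : (ZMod ℓ)ˣ) : ZMod ℓ) := by
      have h1 : ((ℓ' * c : ℕ) : ZMod ℓ) = (B : ZMod ℓ) := by
        rw [← hc]; push_cast; rw [ZMod.natCast_self, zero_mul, add_zero]
      push_cast at h1
      rw [hBb, ← hu] at h1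
      -- h1 : ↑u * ↑c = ↑b
      rw [Units.val_mul, ← h1, mul_comm ((u : ZMod ℓ)) _, mul_assoc, Units.mul_inv, mul_one]
    rw [hc, ← hcZ, solo_apply_val_natCast_div φ hper]
    congr 1; rw [hnQ]; push_cast; field_simp
  -- (iv) the unit points: bijection with the units `a ≡ b (mod ℓ)` of `ℤ/n`
  have hval : ∀ a : (ZMod n)ˣ, ZMod.unitsMap hℓn a = b →
      B + ℓ * (((a : ZMod n)).val / ℓ) = ((a : ZMod n)).val := by
    intro a ha
    have h1 : (((a : ZMod n)).val : ZMod ℓ) = (b : ZMod ℓ) := by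
      rw [← ha, ZMod.unitsMap_val, ZMod.cast_eq_val]
    have h2 : ((a : ZMod n)).val % ℓ = B := by
      have := congrArg ZMod.val h1
      rwa [ZMod.val_natCast] at this
    conv_rhs => rw [← Nat.mod_add_div ((a : ZMod n)).val ℓ]
    rw [h2]
  have hlt : ∀ a : (ZMod n)ˣ, ((a : ZMod n)).val / ℓ < ℓ' := by
    intro a
    apply Nat.div_lt_of_lt_mul
    exact (ZMod.val_lt (a : ZMod n)).trans_eq hn
  have hcopj : ∀ j : ℕ, ¬ ℓ' ∣ B + ℓ * j → Nat.Coprime (B + ℓ * j) n := by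
    intro j hj
    rw [hn]
    refine Nat.Coprime.mul_right ?_ ?_
    · rw [Nat.coprime_comm, Nat.Prime.coprime_iff_not_dvd hℓp]
      intro h
      have : ℓ ∣ B := (Nat.dvd_add_left ⟨j, rfl⟩).mp h
      exact hB0 (Nat.eq_zero_of_dvd_of_lt this hBlt)
    · rw [Nat.coprime_comm, Nat.Prime.coprime_iff_not_dvd hℓ'p]
      exact hj
  have hsum : (∑ a ∈ (Finset.univ : Finset (ZMod n)ˣ).filter (fun a => ZMod.unitsMap hℓn a = b),
        φ ((((a : ZMod n)).val : ℚ) / n)) =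
      Finset.sum ((Finset.univ : Finset (Fin ℓ')).filter (fun j : Fin ℓ' => ¬ ℓ' ∣ B + ℓ * (j : ℕ)))
        (fun j : Fin ℓ' => φ (((B + ℓ * (j : ℕ) : ℕ) : ℚ) / n)) := by
    refine Finset.sum_nbij'
      (fun a : (ZMod n)ˣ => (⟨((a : ZMod n)).val / ℓ, hlt a⟩ : Fin ℓ'))
      (fun j : Fin ℓ' => if h : Nat.Coprime (B + ℓ * (j : ℕ)) n then ZMod.unitOfCoprime _ h else 1)
      ?_ ?_ ?_ ?_ ?_
    · intro a ha
      rw [Finset.mem_filter] at ha ⊢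
      refine ⟨Finset.mem_univ _, ?_⟩
      show ¬ ℓ' ∣ B + ℓ * (((a : ZMod n)).val / ℓ)
      rw [hval a ha.2]
      have hc : Nat.Coprime ((a : ZMod n)).val ℓ' :=
        Nat.Coprime.coprime_dvd_right (Dvd.intro_left ℓ hn.symm) (ZMod.val_coe_unit_coprime a)
      exact (Nat.Prime.coprime_iff_not_dvd hℓ'p).mp (Nat.coprime_comm.mp hc)
    · intro j hj
      rw [Finset.mem_filter] at hj ⊢
      refine ⟨Finset.mem_univ _, ?_⟩
      rw [dif_pos (hcopj j hj.2)]
      ext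
      rw [ZMod.unitsMap_val, ZMod.coe_unitOfCoprime, ZMod.cast_natCast hℓn, ← hBb]
      push_cast
      rw [ZMod.natCast_self, zero_mul, add_zero]
    · intro a ha
      rw [Finset.mem_filter] at ha
      have h1 : Nat.Coprime (B + ℓ * (((⟨((a : ZMod n)).val / ℓ, hlt a⟩ : Fin ℓ') : ℕ))) n := by
        show Nat.Coprime (B + ℓ * (((a : ZMod n)).val / ℓ)) n
        rw [hval a ha.2]; exact ZMod.val_coe_unit_coprime a
      rw [dif_pos h1]
      ext
      rw [ZMod.coe_unitOfCoprime]
      show (((B + ℓ * (((a : ZMod n)).val / ℓ) : ℕ)) : ZMod n) = (a : ZMod n)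
      rw [hval a ha.2, ZMod.natCast_zmod_val]
    · intro j hj
      rw [Finset.mem_filter] at hj
      apply Fin.ext
      show (((if h : Nat.Coprime (B + ℓ * (j : ℕ)) n then ZMod.unitOfCoprime _ h else 1 :
          (ZMod n)ˣ) : ZMod n)).val / ℓ = (j : ℕ)
      rw [dif_pos (hcopj j hj.2), ZMod.coe_unitOfCoprime, ZMod.val_cast_of_lt,
        Nat.add_mul_div_left _ _ hℓp.pos, Nat.div_eq_of_lt hBlt, zero_add]
      calc B + ℓ * (j : ℕ) < ℓ + ℓ * (j : ℕ) := by omega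
        _ = ℓ * ((j : ℕ) + 1) := by ring
        _ ≤ ℓ * ℓ' := Nat.mul_le_mul_left _ (by have := j.isLt; omega)
        _ = n := hn.symm
    · intro a ha
      rw [Finset.mem_filter] at ha
      show φ ((((a : ZMod n)).val : ℚ) / n) = φ (((B + ℓ * (((a : ZMod n)).val / ℓ) : ℕ) : ℚ) / n)
      rw [hval a ha.2]
  -- (v) assemble with the Hecke relation
  have hsplit := Finset.sum_filter_add_sum_filter_not (Finset.univ : Finset (Fin ℓ'))
    (fun j : Fin ℓ' => ℓ' ∣ B + ℓ * (j : ℕ)) (fun j : Fin ℓ' => φ (((B + ℓ * (j : ℕ) : ℕ) : ℚ) / n))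
  have hsing : (Finset.univ : Finset (Fin ℓ')).filter (fun j : Fin ℓ' => ℓ' ∣ B + ℓ * (j : ℕ)) =
      {j₀} := by
    ext j
    simp only [Finset.mem_filter, Finset.mem_univ, true_and, Finset.mem_singleton]
    exact ⟨huniq j, fun h => by rw [h]; exact ⟨c, hc⟩⟩
  rw [hsing, Finset.sum_singleton] at hsplit
  have hH' : a' * φ (((B : ℚ) / ℓ)) =
      ∑ j : Fin ℓ', φ (((B + ℓ * (j : ℕ) : ℕ) : ℚ) / n) + φ (ℓ' * (((B : ℚ) / ℓ))) := by
    rw [hH]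
    congr 1
    exact Finset.sum_congr rfl fun j _ => by rw [e1]
  rw [hsum, ← e3, ← e2]
  linear_combination hsplit - hH'

/-- **Projection formula.** For `n = ℓ ℓ'` and any coefficient function `c` on `(ℤ/ℓ)ˣ`:
`∑_{a ∈ (ℤ/n)ˣ} φ(a/n) c(a mod ℓ) = a' ∑_b φ(b/ℓ) c(b) - ∑_b φ(b/ℓ) (c(bu) + c(bu⁻¹))`,
`u = ℓ' mod ℓ`. [folklore] -/
theorem solo_sum_units_mul_apply [CommRing R] (hper : ∀ (q : ℚ) (z : ℤ), φ (q + z) = φ q)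
    (hn : n = ℓ * ℓ') (hne : ℓ ≠ ℓ') (hℓn : ℓ ∣ n) (a' : R)
    (hH : ∀ b : (ZMod ℓ)ˣ, a' * φ (((b : ZMod ℓ).val : ℚ) / ℓ) =
      ∑ j : Fin ℓ', φ (((((b : ZMod ℓ).val : ℚ) / ℓ) + j) / ℓ') +
        φ (ℓ' * ((((b : ZMod ℓ).val : ℚ) / ℓ))))
    (u : (ZMod ℓ)ˣ) (hu : (u : ZMod ℓ) = (ℓ' : ZMod ℓ)) (c : (ZMod ℓ)ˣ → R) :
    ∑ a : (ZMod n)ˣ, φ ((((a : ZMod n)).val : ℚ) / n) * c (ZMod.unitsMap hℓn a) =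
      a' * (∑ b : (ZMod ℓ)ˣ, φ (((b : ZMod ℓ).val : ℚ) / ℓ) * c b)
        - ∑ b : (ZMod ℓ)ˣ, φ (((b : ZMod ℓ).val : ℚ) / ℓ) * (c (b * u) + c (b * u⁻¹)) := by
  classical
  rw [← Finset.sum_fiberwise_of_maps_to (t := (Finset.univ : Finset (ZMod ℓ)ˣ))
    (g := fun a : (ZMod n)ˣ => ZMod.unitsMap hℓn a) (fun a _ => Finset.mem_univ _)
    (fun a : (ZMod n)ˣ => φ ((((a : ZMod n)).val : ℚ) / n) * c (ZMod.unitsMap hℓn a))]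
  have inner : ∀ b : (ZMod ℓ)ˣ,
      (∑ a ∈ (Finset.univ : Finset (ZMod n)ˣ).filter (fun a => ZMod.unitsMap hℓn a = b),
        φ ((((a : ZMod n)).val : ℚ) / n) * c (ZMod.unitsMap hℓn a)) =
      (a' * φ (((b : ZMod ℓ).val : ℚ) / ℓ) - φ ((((b * u : (ZMod ℓ)ˣ) : ZMod ℓ).val : ℚ) / ℓ)
        - φ ((((b * u⁻¹ : (ZMod ℓ)ˣ) : ZMod ℓ).val : ℚ) / ℓ)) * c b := by
    intro b
    rw [← solo_sum_fiber φ hper hn hne hℓn a' b (hH b) u hu, Finset.sum_mul]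
    refine Finset.sum_congr rfl fun a ha => ?_
    rw [(Finset.mem_filter.mp ha).2]
  rw [Finset.sum_congr rfl fun b _ => inner b]
  have s1 : ∑ b : (ZMod ℓ)ˣ, φ ((((b * u : (ZMod ℓ)ˣ) : ZMod ℓ).val : ℚ) / ℓ) * c b =
      ∑ b : (ZMod ℓ)ˣ, φ (((b : ZMod ℓ).val : ℚ) / ℓ) * c (b * u⁻¹) :=
    Fintype.sum_equiv (Equiv.mulRight u) _ _
      (fun b => by simp only [Equiv.coe_mulRight, mul_inv_cancel_right])
  have s2 : ∑ b : (ZMod ℓ)ˣ, φ ((((b * u⁻¹ : (ZMod ℓ)ˣ) : ZMod ℓ).val : ℚ) / ℓ) * c b =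
      ∑ b : (ZMod ℓ)ˣ, φ (((b : ZMod ℓ).val : ℚ) / ℓ) * c (b * u) :=
    Fintype.sum_equiv (Equiv.mulRight u⁻¹) _ _
      (fun b => by simp only [Equiv.coe_mulRight, inv_mul_cancel_right])
  have s3 : ∑ b : (ZMod ℓ)ˣ, a' * φ (((b : ZMod ℓ).val : ℚ) / ℓ) * c b =
      a' * ∑ b : (ZMod ℓ)ˣ, φ (((b : ZMod ℓ).val : ℚ) / ℓ) * c b := by
    rw [Finset.mul_sum]
    exact Finset.sum_congr rfl fun b _ => by ring
  simp only [sub_mul, Finset.sum_sub_distrib, s1, s2, s3, mul_add, Finset.sum_add_distrib]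
  ring

/-- **Shifted coefficients.** If `c(bu) + c(bu⁻¹) = 2 c(b) + κ` for every `b ∈ (ℤ/ℓ)ˣ` (e.g.
`c` an additive character: `κ = 0`; `c = q ∘ ψ` with `q(x) = x² - x`: `κ = 2 ψ(u)²`), then
`∑_{a ∈ (ℤ/n)ˣ} φ(a/n) c(a mod ℓ) = (a' - 2) ∑_b φ(b/ℓ) c(b) - κ ∑_b φ(b/ℓ)`. [folklore] -/
theorem solo_sum_units_mul_apply_of_shift [CommRing R]
    (hper : ∀ (q : ℚ) (z : ℤ), φ (q + z) = φ q)
    (hn : n = ℓ * ℓ') (hne : ℓ ≠ ℓ') (hℓn : ℓ ∣ n) (a' : R)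
    (hH : ∀ b : (ZMod ℓ)ˣ, a' * φ (((b : ZMod ℓ).val : ℚ) / ℓ) =
      ∑ j : Fin ℓ', φ (((((b : ZMod ℓ).val : ℚ) / ℓ) + j) / ℓ') +
        φ (ℓ' * ((((b : ZMod ℓ).val : ℚ) / ℓ))))
    (u : (ZMod ℓ)ˣ) (hu : (u : ZMod ℓ) = (ℓ' : ZMod ℓ)) (c : (ZMod ℓ)ˣ → R) (κ : R)
    (hc : ∀ b : (ZMod ℓ)ˣ, c (b * u) + c (b * u⁻¹) = 2 * c b + κ) :
    ∑ a : (ZMod n)ˣ, φ ((((a : ZMod n)).val : ℚ) / n) * c (ZMod.unitsMap hℓn a) =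
      (a' - 2) * (∑ b : (ZMod ℓ)ˣ, φ (((b : ZMod ℓ).val : ℚ) / ℓ) * c b)
        - κ * ∑ b : (ZMod ℓ)ˣ, φ (((b : ZMod ℓ).val : ℚ) / ℓ) := by
  rw [solo_sum_units_mul_apply φ hper hn hne hℓn a' hH u hu c]
  have : ∑ b : (ZMod ℓ)ˣ, φ (((b : ZMod ℓ).val : ℚ) / ℓ) * (c (b * u) + c (b * u⁻¹)) =
      2 * (∑ b : (ZMod ℓ)ˣ, φ (((b : ZMod ℓ).val : ℚ) / ℓ) * c b)
        + κ * ∑ b : (ZMod ℓ)ˣ, φ (((b : ZMod ℓ).val : ℚ) / ℓ) := by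
    rw [Finset.mul_sum, Finset.mul_sum, ← Finset.sum_add_distrib]
    exact Finset.sum_congr rfl fun b _ => by rw [hc]; ring
  rw [this]; ring

end Engine

section Characters

variable (p : ℕ) [hp : Fact p.Prime]

/-- `Ψ(a) = ∑_{ℓ ∣ n} ψ_ℓ(a mod ℓ) ∈ ℤ/p` (written additively): the exponent of the order-`p`
character `a ↦ ζ_p^{Ψ(a)} = ∏_{ℓ ∣ n} χ_ℓ(a)`, `χ_ℓ = ζ_p^{ψ_ℓ}`. -/
def soloCharSum (n : ℕ) [NeZero n] (ψ : (ℓ : ℕ) → (ZMod ℓ)ˣ →* Multiplicative (ZMod p))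
    (a : (ZMod n)ˣ) : ZMod p :=
  ∑ ℓ ∈ n.primeFactors.attach,
    Multiplicative.toAdd (ψ ℓ.1 (ZMod.unitsMap (Nat.dvd_of_mem_primeFactors ℓ.2) a))

/-- `2 · C(v, 2) = v (v - 1)` in `ℤ/p`. [folklore] -/
theorem solo_two_mul_cast_choose_two (v : ℕ) :
    (2 : ZMod p) * (v.choose 2 : ZMod p) = (v : ZMod p) * ((v : ZMod p) - 1) := by
  rcases v with _ | v
  · simp
  · have h := Nat.add_one_mul_choose_eq v 1
    rw [Nat.choose_one_right] at h
    have h' := congrArg (Nat.cast : ℕ → ZMod p) h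
    push_cast at h'
    push_cast
    linear_combination -h'

end Characters

section CuspForm

variable {N : ℕ} (f : CuspForm (Gamma0 N) 2) (p : ℕ) [hp : Fact p.Prime]

/-- `φ̄(x) = \overline{[x]⁺} ∈ 𝔽_p`: the rational plus symbol reduced mod `p` (meaningful at the
`p`-integral arguments only; all arguments used below have denominator dividing `n`). -/
def soloSymbolModP (x : ℚ) : ZMod p := ((ratPlusSymbol f x : ℚ) : ZMod p)

/-- `φ̄` is `1`-periodic. [folklore] -/
theorem soloSymbolModP_add_intCast [NeZero N] (x : ℚ) (z : ℤ) :
    soloSymbolModP f p (x + z) = soloSymbolModP f p x := by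
  unfold soloSymbolModP; rw [ratPlusSymbol_add_intCast_eq]

/-- **The twisted depth polynomial** `T(X) = ∑_{a ∈ (ℤ/n)ˣ} \overline{[a/n]⁺} (1 + X)^{Ψ(a)}
∈ 𝔽_p[X]`: the image of the order-`p` twisted special value
`S = ∑_a [a/n]⁺ ζ_p^{Ψ(a)} ∈ ℤ_{(p)}[ζ_p]` under `ζ_p ↦ 1 + X`
(`ℤ_{(p)}[ζ_p]/(p) = 𝔽_p[X]/(X^{p-1})`, `π = ζ_p - 1 ↦ X`). -/
def soloTwistedDepthPolynomial (n : ℕ) [NeZero n]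
    (ψ : (ℓ : ℕ) → (ZMod ℓ)ˣ →* Multiplicative (ZMod p)) : (ZMod p)[X] :=
  ∑ a : (ZMod n)ˣ, C (soloSymbolModP f p (((a : ZMod n).val : ℚ) / n)) *
    (1 + X) ^ (soloCharSum p n ψ a).val

/-- `coeff_k T = ∑_a \overline{[a/n]⁺} · C(Ψ(a), k)`. [folklore] -/
theorem solo_coeff_twistedDepthPolynomial (n : ℕ) [NeZero n]
    (ψ : (ℓ : ℕ) → (ZMod ℓ)ˣ →* Multiplicative (ZMod p)) (k : ℕ) :
    (soloTwistedDepthPolynomial f p n ψ).coeff k =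
      ∑ a : (ZMod n)ˣ, soloSymbolModP f p (((a : ZMod n).val : ℚ) / n) *
        ((soloCharSum p n ψ a).val.choose k : ZMod p) := by
  rw [soloTwistedDepthPolynomial, Polynomial.finsetSum_coeff]
  refine Finset.sum_congr rfl fun a _ => ?_
  rw [Polynomial.coeff_C_mul, Polynomial.coeff_one_add_X_pow]

end CuspForm

end Summit.BirchSwinnertonDyer.BirchSwinnertonDyer.Theorems

end
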